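import Mathlib.Analysis.SpecialFunctions.SmoothTransition
import Mathlib.Analysis.Calculus.Deriv.MeanValue

/-!
# Crux `AdiabaticMultiKerrILED` (line `Sketch`) — the tails-cut zone has a single photon sphere

Helper file for the crux `stmt-FinalStateConjecture-14310`
(`Summit.FinalStateConjecture.FinalStateConjecture.Theses.ClusterCompleteness.AdiabaticMultiKerrILED`),
line `Sketch`, stub `tailsCut_nullPotential_strictAntiOn` (lead c7, wave 1).

For `a = 0` the rest-frame tails-cut zone of the crux is the static spherically symmetric metric
with `f(r) = 1 − 2Mχ(r)/r`, `χ(r) = Real.smoothTransition (2 − r/(8M))` (`χ = 1` for `r ≤ 8M`,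
`χ = 0` for `r ≥ 16M`). Its null-geodesic potential is `V(r) = f(r)/r² = (1 − 2Mχ(r)/r)/r²`.
This file proves that `V` is STRICTLY DECREASING on `[3M, ∞)`
(`tailsCut_nullPotential_strictAntiOn`), taking the slope bound `|smoothTransition′| ≤ 4` as a
hypothesis (it is proved in the sibling file `…SmoothTransitionSlope`): the tails-cut metric has
exactly one photon sphere, at `r = 3M`, like Schwarzschild — the structural input of every
Morawetz estimate for the zone.

Proof (Mathlib only). Write `S = Real.smoothTransition`. For `M ≠ 0` and `r ≠ 0`,
`V′(r) = −(2/r⁴)·(r − 3M·S(2 − r/(8M)) − r·S′(2 − r/(8M))/8)`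
(`hasDerivAt_tailsCutNullPotential`, chain and quotient rules). On `3M < r < 8M` the argument
`2 − r/(8M)` exceeds `1`, where `S` is locally the constant `1`, so `S = 1`, `S′ = 0` there and the
bracket is `r − 3M > 0`; on `r ≥ 8M`, `S ≤ 1` and `|S′| ≤ 4` give the bracket
`≥ r − 3M − r/2 ≥ M > 0`. Hence `V′ < 0` on `(3M, ∞) = interior [3M, ∞)`, `V` is continuous on
`[3M, ∞) ⊆ {r ≠ 0}`, and `strictAntiOn_of_deriv_neg` concludes. [folklore]
-/

noncomputable section

-- the doubled `FinalStateConjecture.FinalStateConjecture` path component trips dupNamespace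
set_option linter.dupNamespace false

namespace Summit.FinalStateConjecture.FinalStateConjecture.Theorems

/-- Mathlib's smooth transition `S` is differentiable at every real `x`, with derivative
`deriv S x` (`S` is `C^∞`: `Real.smoothTransition.contDiff`). [folklore] -/
private theorem hasDerivAt_smoothTransition_deriv (x : ℝ) :
    HasDerivAt Real.smoothTransition (deriv Real.smoothTransition x) x :=
  ((Real.smoothTransition.contDiff (n := 1)).differentiable one_ne_zero x).hasDerivAt

/-- `S′ y = 0` for `1 < y`: the smooth transition is the constant `1` on a neighbourhood of such
a `y` (`Real.smoothTransition.one_of_one_le`). [folklore] -/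
private theorem deriv_smoothTransition_eq_zero_of_one_lt {y : ℝ} (hy : 1 < y) :
    deriv Real.smoothTransition y = 0 := by
  have h : deriv Real.smoothTransition y = deriv (fun _ : ℝ ↦ (1 : ℝ)) y := by
    refine Filter.EventuallyEq.deriv_eq ?_
    filter_upwards [lt_mem_nhds hy] with z hz
    exact Real.smoothTransition.one_of_one_le hz.le
  rw [h, deriv_const]

/-- The derivative of the tails-cut null potential `V(r) = (1 − 2Mχ(r)/r)/r²`,
`χ(r) = S(2 − r/(8M))` (`S = Real.smoothTransition`, `M ≠ 0`), at every `r ≠ 0`: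
`V′(r) = −(2/r⁴)·(r − 3M·S(2 − r/(8M)) − r·S′(2 − r/(8M))/8)`. [folklore] -/
theorem hasDerivAt_tailsCutNullPotential {M r : ℝ} (hM : M ≠ 0) (hr : r ≠ 0) :
    HasDerivAt (fun r : ℝ ↦ (1 - 2 * M * Real.smoothTransition (2 - r / (8 * M)) / r) / r ^ 2)
      (-(2 / r ^ 4) * (r - 3 * M * Real.smoothTransition (2 - r / (8 * M)) -
        r * deriv Real.smoothTransition (2 - r / (8 * M)) / 8)) r := by
  have hinner : HasDerivAt (fun x : ℝ ↦ 2 - x / (8 * M)) (-(1 / (8 * M))) r :=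
    ((hasDerivAt_id' r).div_const (8 * M)).const_sub 2
  have hχ : HasDerivAt (fun x : ℝ ↦ Real.smoothTransition (2 - x / (8 * M)))
      (deriv Real.smoothTransition (2 - r / (8 * M)) * -(1 / (8 * M))) r := by
    have h := (hasDerivAt_smoothTransition_deriv (2 - r / (8 * M))).comp r hinner
    exact h
  have hnum : HasDerivAt (fun x : ℝ ↦ 1 - 2 * M * Real.smoothTransition (2 - x / (8 * M)) / x)
      (-((2 * M * (deriv Real.smoothTransition (2 - r / (8 * M)) * -(1 / (8 * M))) * r -
          2 * M * Real.smoothTransition (2 - r / (8 * M)) * 1) / r ^ 2)) r :=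
    ((hχ.const_mul (2 * M)).fun_div (hasDerivAt_id' r) hr).const_sub 1
  have hsq : HasDerivAt (fun x : ℝ ↦ x ^ 2) (2 * r) r := by
    simpa using hasDerivAt_pow 2 r
  refine (hnum.fun_div hsq (pow_ne_zero 2 hr)).congr_deriv ?_
  field_simp
  ring

/-- **Stub `tailsCut_nullPotential_strictAntiOn`** (crux `AdiabaticMultiKerrILED`, line `Sketch`).
The null-geodesic potential `V(r) = (1 − 2Mχ(r)/r)/r²` of the `a = 0` tails-cut zone,
`χ(r) = Real.smoothTransition (2 − r/(8M))`, is strictly decreasing on `[3M, ∞)` as soon as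
`|smoothTransition′| ≤ 4`: the tails-cut Schwarzschild metric has a single photon sphere, at
`r = 3M`. [folklore] -/
theorem tailsCut_nullPotential_strictAntiOn : ∀ M : ℝ, 0 < M →
    (∀ x : ℝ, |deriv Real.smoothTransition x| ≤ 4) →
    StrictAntiOn (fun r : ℝ ↦ (1 - 2 * M * Real.smoothTransition (2 - r / (8 * M)) / r) / r ^ 2)
      (Set.Ici (3 * M)) := by
  intro M hM hD
  refine strictAntiOn_of_deriv_neg (convex_Ici _) ?_ ?_
  · intro r hr
    have hr0 : r ≠ 0 := (lt_of_lt_of_le (by positivity) (Set.mem_Ici.1 hr)).ne'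
    exact (hasDerivAt_tailsCutNullPotential hM.ne' hr0).continuousAt.continuousWithinAt
  · rw [interior_Ici]
    intro r hr
    rw [Set.mem_Ioi] at hr
    have hr0 : 0 < r := lt_trans (by positivity) hr
    rw [(hasDerivAt_tailsCutNullPotential hM.ne' hr0.ne').deriv]
    have hbr : 0 < r - 3 * M * Real.smoothTransition (2 - r / (8 * M)) -
        r * deriv Real.smoothTransition (2 - r / (8 * M)) / 8 := by
      rcases lt_or_ge r (8 * M) with h8 | h8
      · -- exact Schwarzschild region: `χ = 1`, `χ′ = 0`
        have harg : 1 < 2 - r / (8 * M) := by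
          have : r / (8 * M) < 1 := (div_lt_one (by positivity)).2 h8
          linarith
        rw [Real.smoothTransition.one_of_one_le harg.le,
          deriv_smoothTransition_eq_zero_of_one_lt harg]
        linarith
      · -- transition and flat regions: `χ ≤ 1`, `|χ′| ≤ 4/(8M)`
        have h1 : 3 * M * Real.smoothTransition (2 - r / (8 * M)) ≤ 3 * M :=
          mul_le_of_le_one_right (by positivity) (Real.smoothTransition.le_one _)
        have h2 : r * deriv Real.smoothTransition (2 - r / (8 * M)) ≤ r * 4 :=
          mul_le_mul_of_nonneg_left ((le_abs_self _).trans (hD _)) hr0.le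
        linarith
    have h4 : 0 < 2 / r ^ 4 := by positivity
    exact mul_neg_of_neg_of_pos (neg_lt_zero.2 h4) hbr

end Summit.FinalStateConjecture.FinalStateConjecture.Theorems
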